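import Mathlib
import Summits.ABC.ABC.Theorems.ThreeSlotZooSquareSquare
import Summits.ABC.ABC.Theorems.IneffectiveSubspaceUniformSadicTowerFourThreeSlotQuasiPolynomial

/-!
# One-slot lemmas for `ZooSorting` (stmt-ABC-24024): `c − 1` with two prime factors

Support for the birth stub `stub_oneSlot_primePow` of `route-ABC-ThreeSlotCyclotomicDescent`
(triples `1 + b = c` with `c` a prime power and `ω(b) ≤ 2`):

* `exists_eq_pow_mul_pow_of_card_primeFactors_eq_two` — a number with exactly two prime factors is
  `p^x · q^y` (`p < q` primes, `x, y ≥ 1`);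
* `oneSlot_card_add_le` — for an abc triple `(1, b, c)` with `ω(bc) ≤ 3`: `ω(b) + ω(c) ≤ 3`;
* `fourPow_le_five_rad` — `1 + p^x q^y = 4^m` forces `(b, c) ∈ {(15, 16), (63, 64)}`, whence
  `c ≤ 5 · rad` (Catalan-lite on the coprime factors `2^m ∓ 1`);
* `oddExp_le_five_rad` — `1 + 2^x q = r^z` with `z` odd gives `c ≤ q·r ≤ rad` (2-adically,
  `2^x ∣ r − 1` because `(r^z − 1)/(r − 1)` is odd).
-/

namespace Summit.ABC.ABC.Theorems.ThreeSlotOneSlot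

open Literature.NumberTheory.DiophantineGeometry (IsABCTriple rad rad_def)
open UniqueFactorizationMonoid (radical dvd_radical_iff_of_irreducible)
open Summit.ABC.ABC.Theorems.UniformSadicTowerFour.ThreeSlotWall (primeFactors_abc_eq_union')
open Summit.ABC.ABC.Theorems.ThreeSlotZooSquareRung (pow_add_one_ne_two_pow pow_eq_two_pow_add_one)
open Summit.ABC.ABC.Theorems.ThreeSlotZooSquareSquare (mul_dvd_radical)
open Finset

/-- A natural number with exactly two prime factors is `p^x · q^y` with `p < q` primes and
`x, y ≥ 1`. [folklore] -/
theorem exists_eq_pow_mul_pow_of_card_primeFactors_eq_two {n : ℕ} (h : n.primeFactors.card = 2) :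
    ∃ p q x y : ℕ, p.Prime ∧ q.Prime ∧ p < q ∧ 1 ≤ x ∧ 1 ≤ y ∧ n = p ^ x * q ^ y := by
  have hn : n ≠ 0 := by
    rintro rfl
    simp at h
  -- the factorisation as a product over the two prime factors
  have key : ∀ p q : ℕ, p ≠ q → n.primeFactors = {p, q} →
      p.Prime ∧ q.Prime ∧ 1 ≤ n.factorization p ∧ 1 ≤ n.factorization q ∧
      n = p ^ n.factorization p * q ^ n.factorization q := by
    intro p q hpq hpf
    have hp : p ∈ n.primeFactors := by rw [hpf]; simp
    have hq : q ∈ n.primeFactors := by rw [hpf]; simp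
    have hp' := Nat.mem_primeFactors.mp hp
    have hq' := Nat.mem_primeFactors.mp hq
    refine ⟨hp'.1, hq'.1, hp'.1.factorization_pos_of_dvd hn hp'.2.1,
      hq'.1.factorization_pos_of_dvd hn hq'.2.1, ?_⟩
    conv_lhs => rw [← Nat.prod_factorization_pow_eq_self hn]
    rw [Finsupp.prod, Nat.support_factorization, hpf, Finset.prod_pair hpq]
  obtain ⟨p, q, hpq, hpf⟩ := Finset.card_eq_two.mp h
  rcases lt_or_gt_of_ne hpq with hlt | hgt
  · obtain ⟨hp, hq, hx, hy, heq⟩ := key p q hpq hpf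
    exact ⟨p, q, _, _, hp, hq, hlt, hx, hy, heq⟩
  · rw [Finset.pair_comm] at hpf
    obtain ⟨hq, hp, hy, hx, heq⟩ := key q p hpq.symm hpf
    exact ⟨q, p, _, _, hq, hp, hgt, hy, hx, heq⟩

/-- For an abc triple `(1, b, c)` with `ω(bc) ≤ 3`: `ω(b) + ω(c) ≤ 3`. [folklore] -/
theorem oneSlot_card_add_le {b c : ℕ} (h : IsABCTriple 1 b c)
    (hω : (1 * b * c).primeFactors.card ≤ 3) :
    b.primeFactors.card + c.primeFactors.card ≤ 3 := by
  obtain ⟨hU, hD⟩ := primeFactors_abc_eq_union' h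
  rw [hU, Finset.card_union_of_disjoint hD, one_mul] at hω
  exact hω

/-- Splitting a coprime product of two prime powers. [folklore] -/
theorem eq_pow_of_coprime_mul_eq {p q x y t s : ℕ} (hp : p.Prime) (hq : q.Prime)
    (hts : Nat.Coprime t s) (h : t * s = p ^ x * q ^ y) (hpt : p ∣ t) (hqs : q ∣ s) :
    t = p ^ x ∧ s = q ^ y := by
  have hqt : ¬ q ∣ t := fun hq' => hq.one_lt.ne' (Nat.eq_one_of_dvd_coprimes hts hq' hqs)
  have hps : ¬ p ∣ s := fun hp' => hp.one_lt.ne' (Nat.eq_one_of_dvd_coprimes hts hpt hp')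
  have ct : Nat.Coprime t (q ^ y) :=
    Nat.Coprime.pow_right _ ((Nat.Prime.coprime_iff_not_dvd hq).mpr hqt).symm
  have cs : Nat.Coprime s (p ^ x) :=
    Nat.Coprime.pow_right _ ((Nat.Prime.coprime_iff_not_dvd hp).mpr hps).symm
  have ht1 : t ∣ p ^ x := ct.dvd_of_dvd_mul_right (h ▸ Dvd.intro s rfl)
  have hs1 : s ∣ q ^ y := cs.dvd_of_dvd_mul_left (h ▸ Dvd.intro_left t rfl)
  obtain ⟨i, hi, rfl⟩ := (Nat.dvd_prime_pow hp).mp ht1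
  obtain ⟨j, hj, rfl⟩ := (Nat.dvd_prime_pow hq).mp hs1
  have cpq : Nat.Coprime (p ^ x) (q ^ j) :=
    Nat.Coprime.pow _ _ ((Nat.coprime_primes hp hq).mpr fun e => hqt (e ▸ hpt))
  have cqp : Nat.Coprime (q ^ y) (p ^ i) :=
    Nat.Coprime.pow _ _ ((Nat.coprime_primes hq hp).mpr fun e => hps (e ▸ hqs))
  have h1 : p ^ x ∣ p ^ i := cpq.dvd_of_dvd_mul_right (h.symm ▸ Dvd.intro _ rfl)
  have h2 : q ^ y ∣ q ^ j := cqp.dvd_of_dvd_mul_left (h.symm ▸ Dvd.intro_left _ rfl)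
  have hxi : x ≤ i := (Nat.pow_dvd_pow_iff_le_right hp.one_lt).mp h1
  have hyj : y ≤ j := (Nat.pow_dvd_pow_iff_le_right hq.one_lt).mp h2
  exact ⟨by rw [le_antisymm hi hxi], by rw [le_antisymm hj hyj]⟩

/-- The case analysis behind `fourPow_le_five_rad`: `t = P^X`, `t + 2 = Q^Y`, `t + 1 = 2^m` with
`P, Q` prime and `X, Y ≥ 1` forces `(t+1)^2 ≤ 10·P·Q` (indeed `t ∈ {3, 7}`, by Catalan-lite). -/
theorem fourPow_inner {P Q X Y t m : ℕ} (hP : P.Prime) (hQ : Q.Prime) (hX : 1 ≤ X) (hY : 1 ≤ Y)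
    (ht : t + 1 = 2 ^ m) (h1 : t = P ^ X) (h2 : t + 2 = Q ^ Y) : (t + 1) ^ 2 ≤ 10 * P * Q := by
  -- `X = 1` by Catalan-lite A (`P^X + 1 = 2^m` has no solution with `X ≥ 2`)
  have hX1 : X = 1 := by
    by_contra hX1
    exact pow_add_one_ne_two_pow (m := m) hP.two_le (by omega : 2 ≤ X) (by rw [← h1]; omega)
  subst hX1
  rw [pow_one] at h1
  subst P
  rcases Nat.lt_or_ge Y 2 with hY1 | hY2
  · -- `Y = 1`: `Q = t + 2`
    have hY1 : Y = 1 := by omega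
    subst hY1
    rw [pow_one] at h2
    subst Q
    nlinarith [hP.two_le]
  · -- `Y ≥ 2`: Catalan-lite B gives `Q = 3, Y = 2, 2^m = 8`
    obtain ⟨hQ3, -, hm3⟩ := pow_eq_two_pow_add_one hQ.two_le hY2 (by rw [← h2, ← ht])
    subst hQ3 hm3
    have ht7 : t = 7 := by norm_num at ht; omega
    subst ht7
    norm_num

/-- **`1 + p^x q^y = 4^m`** (the even-power-of-two case of the one-slot cell): then
`c = 4^m ≤ 5 · rad(1 · b · c)` — in fact `(b, c) ∈ {(15, 16), (63, 64)}`. [folklore; Catalan] -/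
theorem fourPow_le_five_rad : ∀ p q x y m : ℕ, p.Prime → q.Prime → p ≠ q → 1 ≤ x → 1 ≤ y →
    1 + p ^ x * q ^ y = 2 ^ (2 * m) → 2 ^ (2 * m) ≤ 5 * rad 1 (p ^ x * q ^ y) (2 ^ (2 * m)) := by
  intro p q x y m hp hq hpq hx hy h
  -- write `2^m = t + 1`, so that `b = t (t + 2)`
  obtain ⟨t, ht⟩ : ∃ t, 2 ^ m = t + 1 := ⟨2 ^ m - 1, by have := Nat.one_le_two_pow (n := m); omega⟩
  have h2m : 2 ^ (2 * m) = (t + 1) ^ 2 := by rw [← ht, ← pow_mul, mul_comm]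
  have hb : t * (t + 2) = p ^ x * q ^ y := by nlinarith
  have hpx : 2 ≤ p ^ x := le_trans hp.two_le (Nat.le_self_pow (by omega) p)
  have hqy : 2 ≤ q ^ y := le_trans hq.two_le (Nat.le_self_pow (by omega) q)
  -- `t ≥ 2` (else `b ∈ {0, 3}`), so `m ≥ 1`… and `t` is odd
  have ht1 : 2 ≤ t := by
    by_contra ht0
    interval_cases t <;> nlinarith
  have hm1 : 1 ≤ m := by
    by_contra hm0
    simp only [not_le, Nat.lt_one_iff] at hm0
    subst hm0; simp at ht; omega
  have htodd : Odd t := by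
    have : Even (2 ^ m) := (Nat.even_pow' (by omega)).mpr even_two
    rw [ht] at this
    exact Nat.odd_iff.mpr (by rcases this with ⟨k, hk⟩; omega)
  have hcop : Nat.Coprime t (t + 2) := by
    have : Nat.Coprime t (2 + t) := Nat.coprime_add_self_right.mpr (Nat.coprime_two_right.mpr htodd)
    rwa [add_comm] at this
  -- where do `p` and `q` go?
  have hx0 : x ≠ 0 := by omega
  have hy0 : y ≠ 0 := by omega
  have hpb : p ∣ t * (t + 2) := by rw [hb]; exact dvd_mul_of_dvd_left (dvd_pow_self p hx0) _
  have hqb : q ∣ t * (t + 2) := by rw [hb]; exact dvd_mul_of_dvd_right (dvd_pow_self q hy0) _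
  have htb : t ∣ p ^ x * q ^ y := by rw [← hb]; exact Dvd.intro _ rfl
  have ht2b : t + 2 ∣ p ^ x * q ^ y := by rw [← hb]; exact Dvd.intro_left _ rfl
  have hpd : p ∣ t ∨ p ∣ t + 2 := hp.dvd_mul.mp hpb
  have hqd : q ∣ t ∨ q ∣ t + 2 := hq.dvd_mul.mp hqb
  -- the radical is at least `2 p q`
  have hbodd : Odd (p ^ x * q ^ y) := by
    rw [← hb]; exact Nat.odd_mul.mpr ⟨htodd, by rcases htodd with ⟨k, hk⟩; exact ⟨k + 1, by omega⟩⟩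
  have hp2 : 2 ≠ p := by
    intro h2; subst h2
    have : Odd (2 ^ x) := Odd.of_dvd_nat hbodd (Dvd.intro _ rfl)
    exact (Nat.not_even_iff_odd.mpr this) (Nat.even_pow.mpr ⟨even_two, hx0⟩)
  have hq2 : 2 ≠ q := by
    intro h2; subst h2
    have : Odd (2 ^ y) := Odd.of_dvd_nat hbodd (Dvd.intro_left _ rfl)
    exact (Nat.not_even_iff_odd.mpr this) (Nat.even_pow.mpr ⟨even_two, hy0⟩)
  have hn : 1 * (p ^ x * q ^ y) * 2 ^ (2 * m) ≠ 0 := by positivity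
  have hrad : 2 * p * q ≤ rad 1 (p ^ x * q ^ y) (2 ^ (2 * m)) := by
    rw [rad_def]
    refine Nat.le_of_dvd (Nat.radical_pos _) (mul_dvd_radical Nat.prime_two hp hq hp2 hq2 hpq hn
      ?_ ?_ ?_)
    · exact Dvd.dvd.mul_left (dvd_pow_self 2 (by omega : 2 * m ≠ 0)) _
    · exact dvd_mul_of_dvd_left (dvd_mul_of_dvd_right (dvd_mul_of_dvd_left (dvd_pow_self p (by omega)) _) _) _
    · exact dvd_mul_of_dvd_left (dvd_mul_of_dvd_right (dvd_mul_of_dvd_right (dvd_pow_self q (by omega)) _) _) _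
  -- it suffices to show `(t+1)^2 ≤ 10 p q`
  suffices hmain : (t + 1) ^ 2 ≤ 10 * p * q by rw [h2m] at hrad ⊢; linarith
  rcases hpd with hpt | hpt2 <;> rcases hqd with hqt | hqt2
  · -- both divide `t`: then `t + 2` is coprime to `b`, so `t + 2 = 1`
    exfalso
    have c1 : Nat.Coprime (t + 2) (p ^ x * q ^ y) :=
      Nat.Coprime.mul_right
        (Nat.Coprime.pow_right _ ((Nat.Prime.coprime_iff_not_dvd hp).mpr fun h' =>
          hp.one_lt.ne' (Nat.eq_one_of_dvd_coprimes hcop hpt h')).symm)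
        (Nat.Coprime.pow_right _ ((Nat.Prime.coprime_iff_not_dvd hq).mpr fun h' =>
          hq.one_lt.ne' (Nat.eq_one_of_dvd_coprimes hcop hqt h')).symm)
    have := Nat.Coprime.eq_one_of_dvd c1 ht2b
    omega
  · -- `p ∣ t`, `q ∣ t + 2`
    obtain ⟨h1, h2⟩ := eq_pow_of_coprime_mul_eq hp hq hcop hb hpt hqt2
    exact fourPow_inner hp hq hx hy ht.symm h1 h2
  · -- `p ∣ t + 2`, `q ∣ t`
    obtain ⟨h1, h2⟩ := eq_pow_of_coprime_mul_eq hq hp hcop (by rw [hb, mul_comm]) hqt hpt2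
    have := fourPow_inner hq hp hy hx ht.symm h1 h2
    linarith [mul_comm p q]
  · -- both divide `t + 2`: then `t` is coprime to `b`, so `t = 1`
    exfalso
    have c1 : Nat.Coprime t (p ^ x * q ^ y) :=
      Nat.Coprime.mul_right
        (Nat.Coprime.pow_right _ ((Nat.Prime.coprime_iff_not_dvd hp).mpr fun h' =>
          hp.one_lt.ne' (Nat.eq_one_of_dvd_coprimes hcop h' hpt2)).symm)
        (Nat.Coprime.pow_right _ ((Nat.Prime.coprime_iff_not_dvd hq).mpr fun h' =>
          hq.one_lt.ne' (Nat.eq_one_of_dvd_coprimes hcop h' hqt2)).symm)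
    have := Nat.Coprime.eq_one_of_dvd c1 htb
    omega

/-- **`1 + 2^x q = r^z` with `z` odd** (one-slot cell, `y = 1`): `c ≤ q · r ≤ rad`, hence
`c ≤ 5 · rad(1 · b · c)`. The point: `(r^z − 1)/(r − 1)` is odd, so `2^x ∣ r − 1 < r` and
`q = (r^z − 1)/2^x > r^(z-1)`. [folklore] -/
theorem oddExp_le_five_rad : ∀ x q r z : ℕ, q.Prime → r.Prime → r ≠ 2 → Odd z →
    1 + 2 ^ x * q = r ^ z → r ^ z ≤ 5 * rad 1 (2 ^ x * q) (r ^ z) := by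
  intro x q r z hq hr hr2 hz h
  have hrodd : Odd r := hr.eq_two_or_odd'.resolve_left hr2
  have hr1 : 1 ≤ r := hr.one_lt.le
  -- geometric sum: `r^z - 1 = S (r - 1)` with `S` odd
  set S := ∑ i ∈ range z, r ^ i with hS
  have hgeom : S * (r - 1) = r ^ z - 1 := geom_sum_mul_of_one_le hr1 z
  have hSodd : S % 2 = 1 := by
    rw [hS, Finset.sum_nat_mod]
    have : ∀ i ∈ range z, r ^ i % 2 = 1 := fun i _ => by
      rw [Nat.pow_mod, Nat.odd_iff.mp hrodd, one_pow]
      rfl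
    rw [Finset.sum_congr rfl this, Finset.sum_const, Finset.card_range, smul_eq_mul, mul_one]
    exact Nat.odd_iff.mp hz
  have hcop : Nat.Coprime (2 ^ x) S :=
    Nat.Coprime.pow_left _ (Nat.coprime_two_right.mpr (Nat.odd_iff.mpr hSodd)).symm
  have hdvd : 2 ^ x ∣ r - 1 := by
    refine hcop.dvd_of_dvd_mul_left ?_
    rw [hgeom]
    exact ⟨q, by omega⟩
  have hle : 2 ^ x ≤ r - 1 := Nat.le_of_dvd (by have := hr.two_le; omega) hdvd
  -- hence `r^z ≤ q r`
  have hq1 := hq.one_lt.le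
  have hmain : r ^ z ≤ q * r := by
    have hle' : 2 ^ x + 1 ≤ r := by have := hr.two_le; omega
    have := Nat.mul_le_mul_right q hle'
    nlinarith
  -- and `q r ≤ rad`
  have hqr : q ≠ r := by
    intro e; subst e
    have : q ∣ 1 := by
      have h1 : q ∣ q ^ z := dvd_pow_self q (by rcases hz with ⟨k, hk⟩; omega)
      have h2 : q ∣ 2 ^ x * q := dvd_mul_left q _
      have : q ∣ q ^ z - 2 ^ x * q := Nat.dvd_sub h1 h2
      have e1 : q ^ z - 2 ^ x * q = 1 := by omega
      rwa [e1] at this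
    exact hq.one_lt.ne' (Nat.eq_one_of_dvd_one this)
  have hn : 1 * (2 ^ x * q) * r ^ z ≠ 0 := by positivity
  have hrad : q * r ≤ rad 1 (2 ^ x * q) (r ^ z) := by
    rw [rad_def]
    refine Nat.le_of_dvd (Nat.radical_pos _) ?_
    have h1 : q ∣ radical (1 * (2 ^ x * q) * r ^ z) :=
      (dvd_radical_iff_of_irreducible hq.prime.irreducible hn).mpr
        (dvd_mul_of_dvd_left (dvd_mul_of_dvd_right (dvd_mul_left q _) _) _)
    have h2 : r ∣ radical (1 * (2 ^ x * q) * r ^ z) :=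
      (dvd_radical_iff_of_irreducible hr.prime.irreducible hn).mpr
        (dvd_mul_of_dvd_right (dvd_pow_self r (by rcases hz with ⟨k, hk⟩; omega)) _)
    exact Nat.Coprime.mul_dvd_of_dvd_of_dvd ((Nat.coprime_primes hq hr).mpr hqr) h1 h2
  calc r ^ z ≤ q * r := hmain
    _ ≤ rad 1 (2 ^ x * q) (r ^ z) := hrad
    _ ≤ 5 * rad 1 (2 ^ x * q) (r ^ z) := by omega

end Summit.ABC.ABC.Theorems.ThreeSlotOneSlot
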